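import Summits.BirchSwinnertonDyer.BirchSwinnertonDyer.Theorems.AdditiveKolyvaginRoadCheb
import HarnessLib

/-!
# Line `admdef`, cell β: ČEBOTAREV WITH THE SIGN at Bertolini–Darmon admissible primes, `p ≥ 5`, FROM THE ADMISSIBLE TARGET
# (W. Zhang 2014 Lemma 7.3 ∕ Bertolini–Darmon 2005 Thm 3.2 at ANY frame where the target exists)
# (crux `AnticyclotomicEisensteinDivisibility`, stmt-BirchSwinnertonDyer-20727; LEAD seat bsd-line-sbc-p1 gen 17,
# `--supports stmt-BirchSwinnertonDyer-20727`; companion of `…AdmdefChebSplitTarget.lean`)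

WHY THIS FILE.  Second half of the kernelisation of (P2) of [NV″] on cell β (crux idea «selwalk», bsd-idea-5 g22): the AKR cell's
(Cheb) theorem `AdditiveKoly.Cheb.exists_admissible_loc_ne_zero` (lead `bsd-wall-akr-p1` g2) is proved under `p ∣ N_E` + Heegner, but
those two hypotheses are consumed ONLY through the admissible target `AdditiveKoly.Cheb.exists_admissible_target` (its l.99).  THIS FILE
re-proves the theorem with the TARGET AS A HYPOTHESIS (`htarget`: for the involutive lift `t = e c₀ e⁻¹` of `c`, some `g₁ ∈ Γ_K` and an
additive frame `e : E(K̄)[p] ≃ 𝔽_p²` with `e (T (g₁ Q)) = diag(ν, 2ν) (e Q)` and `c₀ · res g₁` acting on `E(ℚ̄)[p]` as `diag(ν, 2ν)`), so that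
it applies verbatim on every frame where the target is available — in particular on cell β (`p` split in `K`), where
`…AdmdefChebSplitTarget.exists_admissible_target_of_split` supplies it.  The proof is the AKR proof byte-for-byte except for that
one line (Steps A–H of its module docstring: Gross Prop. 9.3 prescribes the cocycle value, Čebotarev in `Γ_ℚ` on the open set
`c₀ · res(g₁ ρ 𝒩)`, the prime below is inert with Frobenius `τ' = (t⁻¹ g t) g`, the sign computation `(e ξ(τ'))₀ = 1` against
`(τ' − 1)E[p] ⊂ {v₀ = 0}`, Gross Prop. 9.6 at the conjugated Frobenius, admissibility congruences `det = ℓ ≡ 2`, `tr = a_ℓ ≡ 3ν`).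

WHAT IS PROVED (kernel; no definition, no named fact, no `sorry`):
* `exists_admissible_loc_ne_zero_of_target` — `K` imaginary quadratic, `ρ̄_{E,p}` onto, `p ≥ 5`, `c ≠ 1`, `ν = ±1`, the target
  hypothesis, `x ∈ H¹(K, E[p])` non-zero with `c_* x = ν x`, `B₀ ⊂ ℕ` finite ⟹ ∃ Bertolini–Darmon 1-admissible `q ∉ B₀` (sign rule
  `ε_q = ν`) and a place `v ∋ q` of `K` with `loc_v x ≠ 0` in `H¹(K_v, E[p])`.

HONEST FRAMING: a port (one hypothesis generalised) of the AKR theorem; nothing about Heegner points, [NV″] or the crux is asserted.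
BSD is not proved by this file.

References: [cite: WZhang2014, Lemma 7.3] [cite: BertoliniDarmon2005, Thm. 3.2] [cite: GrossLMS1991, Prop. 9.3, 9.6]
[cite: McCallumLMS1991, §3 Prop. 3.1, Cor. 3.2] [cite: TateGCFT1967, §2.4].
-/

-- D-0017: single-problem summit, the namespace repeats the problem name by design.
set_option linter.dupNamespace false
set_option autoImplicit false

noncomputable section

open scoped Classical Pointwise
open Polynomial

namespace Summit.BirchSwinnertonDyer.BirchSwinnertonDyer.Theorems.SignedBaseChangeAcDivAdmdefChebSplit

open WeierstrassCurve Field Function NumberField IsDedekindDomain Rat.HeightOneSpectrum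
open Literature.NumberTheory.EllipticCurves Literature.NumberTheory.GaloisRepresentations Module
open Summit.BirchSwinnertonDyer.BirchSwinnertonDyer.Theorems
open Summit.BirchSwinnertonDyer.BirchSwinnertonDyer.Theorems.AdditiveKoly.Cheb
open Summit.BirchSwinnertonDyer.Rank1Residual.X11b.Three.Koly.Method2

section Main

variable (W : WeierstrassCurve ℚ) (K : Type) [Field K] [NumberField K] [W.IsElliptic] [W.IsGloballyMinimal]

set_option maxHeartbeats 800000 in
-- (same budget as the AKR original `AdditiveKoly.Cheb.exists_admissible_loc_ne_zero`, whose proof this is)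
/-- **Čebotarev with the sign at a general prime `p ≥ 5`, FROM THE ADMISSIBLE TARGET** (W. Zhang 2014 Lemma 7.3 / Bertolini–Darmon 2005
Thm. 3.2, frame-agnostic form).  For `E = W/ℚ` in global minimal form with `ρ̄_{E,p}` onto (`p ≥ 5`), `K` imaginary quadratic with complex
conjugation `c ≠ 1`, a sign `ν = ±1`, and the ADMISSIBLE TARGET available for `(c, ν)` — `htarget`: for every `c₀ ∈ Γ_ℚ` whose transport
`t` lifts `c` involutively, some `g₁ ∈ Γ_K` and additive frame `e : E(K̄)[p] ≃ 𝔽_p²` with `e (T (g₁ Q)) = (ν (e Q)₀, 2ν (e Q)₁)` and `c₀ · res g₁`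
acting on `E(ℚ̄)[p]` the same way (the conclusion of `AdditiveKoly.Cheb.exists_admissible_target`, resp. of
`…AdmdefChebSplitTarget.exists_admissible_target_of_ramifiedPrime`) — a non-zero class `x ∈ H¹(K, E[p])` with `c_* x = ν x`, and a finite
set `B₀ ⊂ ℕ`: there is a Bertolini–Darmon `1`-admissible prime `q ∉ B₀` (with `ε_q = ν`) and a place `v ∋ q` of `K` at which the localisation
of `x` in `H¹(K_v, E[p])` is non-zero.  Proof = the AKR proof verbatim (module docstring). [cite: WZhang2014, Lemma 7.3]
[cite: BertoliniDarmon2005, Thm. 3.2] [cite: GrossLMS1991, Prop. 9.3, 9.6] -/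
theorem exists_admissible_loc_ne_zero_of_target {p : ℕ} [Fact p.Prime] (h5 : 5 ≤ p) (hK : IsImaginaryQuadratic K)
    (hsurj : W.HasSurjectiveModNGaloisRep p)
    {c : K ≃ₐ[ℚ] K} (hc1 : c ≠ 1) {ν : ℤ} (hν : ν = 1 ∨ ν = -1)
    (htarget : ∀ {c₀ : absoluteGaloisGroup ℚ}
      (ht : IsLiftOfAut c (absGaloisTransport (K := ℚ) (L := K) c₀).toRingEquiv),
      (∀ x, (absGaloisTransport (K := ℚ) (L := K) c₀).toRingEquiv
        ((absGaloisTransport (K := ℚ) (L := K) c₀).toRingEquiv x) = x) →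
      ∃ (g₁ : absoluteGaloisGroup K) (e : geomTorsion (W.baseChange K) (p : ℤ) ≃+ (Fin 2 → ZMod p)),
        (∀ Q, e (ht.torsionMap W (p : ℤ) (g₁ • Q)) = ![(ν : ZMod p) * e Q 0, (ν : ZMod p) * 2 * e Q 1]) ∧
        (∀ P : geomTorsion W (p : ℤ),
          e (RatClosure.torsionEquiv (K := K) W (p : ℤ) ((c₀ * absGaloisRestrict ℚ K g₁) • P)) =
            ![(ν : ZMod p) * e (RatClosure.torsionEquiv (K := K) W (p : ℤ) P) 0,
              (ν : ZMod p) * 2 * e (RatClosure.torsionEquiv (K := K) W (p : ℤ) P) 1]))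
    {x : galH1Torsion (W.baseChange K) ((p : ℕ) : ℤ)} (hx0 : x ≠ 0)
    (hxν : conjAct W c ((p : ℕ) : ℤ) x = ν • x) (B₀ : Finset ℕ) :
    ∃ q : ℕ, q ∉ B₀ ∧ BertoliniDarmon2005.IsAdmissiblePrime (W.conductorNorm ℤ) K (fun ℓ ↦ W.frobeniusTrace ℓ) p 1 q ∧
      ∃ v : HeightOneSpectrum (𝓞 K), (q : 𝓞 K) ∈ v.asIdeal ∧
        x ∉ (W.baseChange K).torsionLocalKer (v.adicCompletion K) ((p : ℕ) : ℤ) := by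
  -- adapted from Theorems/AdditiveKolyvaginRoadCheb.lean `exists_admissible_loc_ne_zero` (l.76–362)
  classical
  have hp : p.Prime := Fact.out
  have hp2 : p ≠ 2 := by omega
  haveI : Algebra.IsQuadraticExtension ℚ K := ⟨hK.1⟩
  haveI : IsTotallyComplex K := hK.2
  have hn0 : ((p : ℕ) : ℤ) ≠ 0 := by exact_mod_cast hp.ne_zero
  have hνν : ν * ν = 1 := by rcases hν with rfl | rfl <;> norm_num
  have hννk : (ν : ZMod p) * (ν : ZMod p) = 1 := by rw [← Int.cast_mul, hνν, Int.cast_one]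
  have htwo : (2 : ZMod p) ≠ 0 := by
    intro h
    have : (p : ℕ) ∣ 2 := by
      have h' : ((2 : ℕ) : ZMod p) = 0 := by exact_mod_cast h
      exact (ZMod.natCast_eq_zero_iff 2 p).mp h'
    have := Nat.le_of_dvd (by norm_num) this
    omega
  -- ### Step A: complex conjugation, the involutive lift, the admissible target
  obtain ⟨c₀, hc₀⟩ := exists_isComplexConjugation (Rat.castHom ℝ)
  set t : AlgebraicClosure K ≃+* AlgebraicClosure K :=
    (absGaloisTransport (K := ℚ) (L := K) c₀).toRingEquiv with ht_def
  have ht : IsLiftOfAut c t :=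
    RatClosure.isLiftOfAut_absGaloisTransport_of_isImaginaryQuadratic hK hc1 hc₀
  have hinv : ∀ x, t (t x) = x := fun x ↦
    RatClosure.absGaloisTransport_absGaloisTransport_of_sq_eq_one hc₀.sq_eq_one x
  -- (the one change w.r.t. the AKR proof: the admissible target is the HYPOTHESIS `htarget`)
  obtain ⟨g₁, eT, hG, hγ₁⟩ := htarget ht hinv
  set θ := RatClosure.torsionEquiv (K := K) W ((p : ℕ) : ℤ) with hθ
  set T := ht.torsionMap W ((p : ℕ) : ℤ) with hTdef
  have hTT : ∀ Q, T (T Q) = Q := ht.torsionMap_torsionMap W hinv ((p : ℕ) : ℤ)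
  have hconj : ∀ (g : absoluteGaloisGroup K) (X : geomTorsion (W.baseChange K) ((p : ℕ) : ℤ)),
      ht.conjGalCMH g • X = T (g • T X) := fun g X ↦ by
    rw [← hTT (ht.conjGalCMH g • X), hTdef, ht.torsionMap_smul W ((p : ℕ) : ℤ)]
  have hptor : ∀ X : geomTorsion (W.baseChange K) ((p : ℕ) : ℤ), (p : ℤ) • X = 0 := fun X ↦
    Subtype.ext ((mem_geomTorsion_iff (W.baseChange K) _ _).mp X.2)
  -- the action of `T ∘ g₁` (`= D` in the frame `eT`) and of its square
  have hD1 : ∀ X : geomTorsion (W.baseChange K) ((p : ℕ) : ℤ),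
      eT (T (g₁ • X)) 0 = (ν : ZMod p) * eT X 0 ∧ eT (T (g₁ • X)) 1 = (ν : ZMod p) * 2 * eT X 1 := fun X ↦ by
    rw [hG X]; exact ⟨rfl, rfl⟩
  have hD2 : ∀ X : geomTorsion (W.baseChange K) ((p : ℕ) : ℤ),
      eT (T (g₁ • T (g₁ • X))) 0 = eT X 0 ∧ eT (T (g₁ • T (g₁ • X))) 1 = 4 * eT X 1 := fun X ↦ by
    obtain ⟨h0, h1⟩ := hD1 (T (g₁ • X))
    obtain ⟨h0', h1'⟩ := hD1 X
    rw [h0', ← mul_assoc, hννk, one_mul] at h0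
    rw [h1'] at h1
    refine ⟨h0, ?_⟩
    rw [h1]
    linear_combination (4 * eT X 1) * hννk
  -- ### Step B: the module `E(K̄)[p]` (simple, scalar commutant, `-1`, `2⁻¹`) and Prop. 9.3
  have hsq := RatClosure.exists_smul_eq_of_sq (K := K) W hK.1 (n := ((p : ℕ) : ℤ)) hsurj
  obtain ⟨z, hz⟩ := KolyvaginImage.exists_smul_eq_neg eT hsq
  have hS := KolyvaginImage.eq_bot_or_eq_top eT hsq hp2
  have hCe := KolyvaginImage.exists_eq_zsmul eT hsq hp2
  obtain ⟨u, hu⟩ := KolyvaginImage.exists_two_mul_zsmul_eq eT (p := p) hp2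
  -- the cocycle of `x` (as a `E(K̄)[p]`-valued function `ξ`), the constant `κ₀`, the target value `y`, and `ρ`
  set φ := reprCocycle (W.baseChange K) ((p : ℕ) : ℤ) x with hφdef
  have hclass : oneCocycleClass _ φ = x := oneCocycleClass_reprCocycle (W.baseChange K) _ x
  set ξ : absoluteGaloisGroup K → geomTorsion (W.baseChange K) ((p : ℕ) : ℤ) := fun a ↦ φ.1 a with hξ
  have hcoc : ∀ a b : absoluteGaloisGroup K, ξ (a * b) = ξ a + a • ξ b := fun a b ↦ by
    have := φ.2 a b
    rw [discreteTopRep_ρ_apply] at this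
    exact this
  have hξinv : ∀ a : absoluteGaloisGroup K, ξ a⁻¹ = -(a⁻¹ • ξ a) := fun a ↦ cocycle_apply_inv (W.baseChange K) _ φ a
  obtain ⟨κ₀, hκ₀⟩ : ∃ κ₀ : geomTorsion (W.baseChange K) ((p : ℕ) : ℤ), ξ (ht.conjGalCMH g₁ * g₁) = κ₀ := ⟨_, rfl⟩
  -- the prescribed value: `e y = (2⁻¹ (1 − (e κ₀)₀), 0)`
  set y : geomTorsion (W.baseChange K) ((p : ℕ) : ℤ) := eT.symm ![(2 : ZMod p)⁻¹ * (1 - eT κ₀ 0), 0] with hydef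
  have hy0 : eT y 0 = (2 : ZMod p)⁻¹ * (1 - eT κ₀ 0) := by rw [hydef, eT.apply_symm_apply]; rfl
  have hy1 : eT y 1 = 0 := by rw [hydef, eT.apply_symm_apply]; rfl
  have hind : ∀ a : Fin 1 → ℤ, ∑ i, a i • (![x] : Fin 1 → _) i = 0 → ∀ i, (p : ℤ) ∣ a i := by
    intro a ha i
    have hi : i = 0 := Subsingleton.elim i 0
    subst hi
    simp only [Finset.univ_unique, Fin.default_eq_zero, Fin.isValue, Matrix.cons_val_zero,
      Finset.sum_singleton] at ha
    by_contra hdiv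
    exact hx0 (Summit.BirchSwinnertonDyer.Rank1Residual.X11b.Three.Koly.Method2.Cheb.eq_zero_of_zsmul_eq_zero_of_not_dvd' hp
      (fun x' ↦ zsmul_galH1Torsion_eq_zero (W.baseChange K) _ x') hdiv ha)
  obtain ⟨ρ, hρT, hρ⟩ := exists_h1Eval_eq (W.baseChange K) hp hS hCe hz hu ![x] hind ![y]
  have hρy : ξ ρ = y := by
    have h := hρ 0
    simp only [Matrix.cons_val_zero] at h
    exact h
  -- ### Step C: the finite exceptional set of places of `ℚ`
  have hbad : ((W.baseChange K).badPlaces (𝓞 K)).Finite := (W.baseChange K).finite_badPlaces_holds (𝓞 K)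
  obtain ⟨Tx, hTxfin, hTx⟩ := exists_finite_forall_mem_unramifiedKer (W.baseChange K) (n := ((p : ℕ) : ℤ)) hn0 x
  set B : Finset ℕ := {p} ∪ (W.conductorNorm ℤ).primeFactors ∪ (NumberField.discr K).natAbs.primeFactors ∪ B₀ with hB
  set S₁ : Set (HeightOneSpectrum (𝓞 ℚ)) := {v | ∃ q ∈ B, q.Prime ∧ (q : 𝓞 ℚ) ∈ v.asIdeal} with hS₁
  set S₂ : Set (HeightOneSpectrum (𝓞 ℚ)) := {v | ¬ Algebra.IsUnramifiedIn (𝓞 K) v.asIdeal} with hS₂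
  set S₃ : Set (HeightOneSpectrum (𝓞 ℚ)) :=
    (fun w : HeightOneSpectrum (𝓞 K) ↦ w.under (𝓞 ℚ)) '' ((W.baseChange K).badPlaces (𝓞 K) ∪ Tx) with hS₃
  have hS₁fin : S₁.Finite := by
    have : S₁ ⊆ ⋃ q ∈ (B.filter Nat.Prime), {v | (q : 𝓞 ℚ) ∈ v.asIdeal} := by
      intro v ⟨q, hqB, hq, hqv⟩
      simp only [Set.mem_iUnion, Finset.mem_filter]
      exact ⟨q, ⟨hqB, hq⟩, hqv⟩
    refine Set.Finite.subset (Set.Finite.biUnion (Finset.finite_toSet _) fun q hq ↦ ?_) this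
    rw [Finset.coe_filter, Set.mem_setOf_eq] at hq
    have hsub : {v : HeightOneSpectrum (𝓞 ℚ) | (q : 𝓞 ℚ) ∈ v.asIdeal}.Subsingleton :=
      fun v hv v' hv' ↦ HeightOneSpectrum.eq_of_natCast_mem_rat hq.2 hv hv'
    exact hsub.finite
  have hS₂fin : S₂.Finite := finite_setOf_not_isUnramifiedIn ℚ K
  have hS₃fin : S₃.Finite := (hbad.union hTxfin).image _
  set S := S₁ ∪ S₂ ∪ S₃ with hSdef
  have hSfin : S.Finite := (hS₁fin.union hS₂fin).union hS₃fin
  -- ### Step D: Čebotarev in `Γ_ℚ`: a Frobenius in the open set `c₀ · res(g₁ ρ 𝒩)`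
  set 𝒩 := evalKer (W.baseChange K) ((p : ℕ) : ℤ) ![x] with h𝒩
  have h𝒩open : IsOpen (𝒩 : Set (absoluteGaloisGroup K)) :=
    isOpen_evalKer (W.baseChange K) _ ![x] (isOpen_torsionFixing (W.baseChange K) hn0)
  set O : Set (absoluteGaloisGroup ℚ) :=
    (fun γ ↦ c₀ * γ) '' (absGaloisRestrict ℚ K '' ((fun m ↦ (g₁ * ρ) * m) '' (𝒩 : Set _))) with hO
  have hOopen : IsOpen O := by
    refine (Homeomorph.mulLeft c₀).isOpenMap _ (isOpenMap_absGaloisRestrict K _ ?_)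
    exact (Homeomorph.mulLeft (g₁ * ρ)).isOpenMap _ h𝒩open
  have hOne : O.Nonempty :=
    ⟨c₀ * absGaloisRestrict ℚ K ((g₁ * ρ) * 1), _, ⟨_, ⟨1, 𝒩.one_mem, rfl⟩, rfl⟩, rfl⟩
  obtain ⟨γ, hγO, v, hvS, 𝔓₀, h𝔓₀, hγ⟩ :=
    (absoluteGaloisGroup.frobenius_dense Literature.NumberTheory.Automorphic.chebotarev_artinRep_holds ℚ S
      hSfin).inter_open_nonempty O hOopen hOne
  obtain ⟨_, ⟨_, ⟨m, hm, rfl⟩, rfl⟩, rfl⟩ := hγO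
  set s := ρ * m with hs
  set g := g₁ * s with hg
  have hgeq : g₁ * ρ * m = g := by rw [hg, hs, mul_assoc]
  have hsT : s ∈ torsionFixing (W.baseChange K) ((p : ℕ) : ℤ) := mul_mem hρT hm.1
  dsimp only at hγ
  rw [hgeq] at hγ
  -- ### Step E: the rational prime `ℓ` under `v`
  obtain ⟨ℓ, hℓ, hℓv⟩ := exists_prime_natCast_mem v
  have hℓB : ℓ ∉ B := fun h ↦ hvS (Or.inl (Or.inl ⟨ℓ, h, hℓ, hℓv⟩))
  simp only [hB, Finset.mem_union, Finset.mem_singleton, Nat.mem_primeFactors, not_or] at hℓB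
  obtain ⟨⟨⟨hℓp, hℓN⟩, hℓD⟩, hℓB₀⟩ := hℓB
  have hℓN' : ¬ ℓ ∣ W.conductorNorm ℤ := fun h ↦ hℓN ⟨hℓ, h, (W.conductorNorm_pos_holds).ne'⟩
  have hℓD' : ¬ ((ℓ : ℤ) ∣ NumberField.discr K) := fun h ↦
    hℓD ⟨hℓ, Int.natAbs_dvd_natAbs.mpr h |>.trans (by simp), by simp [NumberField.discr_ne_zero]⟩
  have hunr : Algebra.IsUnramifiedIn (𝓞 K) v.asIdeal := by
    by_contra h; exact hvS (Or.inl (Or.inr h))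
  have hvS₃ : v ∉ S₃ := fun h ↦ hvS (Or.inr h)
  haveI : Fact ℓ.Prime := ⟨hℓ⟩
  have hℓp' : ℓ ≠ p := hℓp
  have hgoodℓ : W.HasGoodReductionAtPrime ℓ := by
    by_contra hbadℓ
    exact hℓN' ((W.dvd_conductorNorm_iff_not_hasGoodReductionAtPrime ℓ).mpr hbadℓ)
  have hvℓ : (primesEquiv v : ℕ) = ℓ := primesEquiv_eq_of_natCast_mem hℓ hℓv
  -- ### Step F: `ℓ` is inert, with a Frobenius `τ' = conj(g) g` over `K`
  have hHi := index_range_absGaloisRestrict_eq_finrank ℚ K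
  haveI hHn : ((absGaloisRestrict ℚ K).range).Normal :=
    Subgroup.normal_of_index_eq_two (hHi.trans hK.1)
  have hI := inertia_le_range_absGaloisRestrict_of_isUnramifiedIn (K := K) hunr h𝔓₀
  have hΦH : c₀ * absGaloisRestrict ℚ K g ∉ (absGaloisRestrict ℚ K).range := by
    intro h
    apply hc₀.not_mem_range_absGaloisRestrict (L := K) IsTotallyComplex.isComplex
    change c₀ ∈ ((absGaloisRestrict ℚ K).range : Set (absoluteGaloisGroup ℚ))
    have h' : c₀ = c₀ * absGaloisRestrict ℚ K g * (absGaloisRestrict ℚ K g)⁻¹ := by group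
    rw [SetLike.mem_coe, h']
    exact Subgroup.mul_mem _ h (Subgroup.inv_mem _ ⟨g, rfl⟩)
  obtain ⟨w, 𝔔, τ', hwv, hwuniq, -, h𝔔w, -, hτ', hresτ'⟩ :=
    exists_place_inert_of_not_mem_range (F := ℚ) (M := K) (hK.1 ▸ Nat.prime_two) hHn
      (hHi.trans rfl) hunr h𝔓₀ hI hγ hΦH
  rw [hK.1, sq_eq_absGaloisRestrict_conjGal_mul hc₀ ht g] at hresτ'
  have hτ'eq : τ' = ht.conjGalCMH g * g := absGaloisRestrict_injective ℚ K hresτ'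
  have hℓw : (ℓ : 𝓞 K) ∈ w.asIdeal := by
    have h1 : (ℓ : 𝓞 ℚ) ∈ (w.under (𝓞 ℚ)).asIdeal := by rw [hwv]; exact hℓv
    rw [HeightOneSpectrum.under_asIdeal, Ideal.under_def, Ideal.mem_comap, map_natCast] at h1
    exact h1
  have hwuniq' : ∀ w' : HeightOneSpectrum (𝓞 K), (ℓ : 𝓞 K) ∈ w'.asIdeal → w' = w := by
    intro w' hw'
    apply hwuniq
    apply HeightOneSpectrum.eq_of_natCast_mem_rat hℓ _ hℓv
    rw [HeightOneSpectrum.under_asIdeal, Ideal.under_def, Ideal.mem_comap, map_natCast]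
    exact hw'
  have hspan : Ideal.span {(ℓ : 𝓞 K)} = w.asIdeal := by
    apply span_natCast_eq_of_unique hℓ w hwuniq'
    haveI : w.asIdeal.LiesOver v.asIdeal := ⟨by rw [← hwv]; rfl⟩
    have hmap : v.asIdeal.map (algebraMap (𝓞 ℚ) (𝓞 K)) = Ideal.span {(ℓ : 𝓞 K)} := by
      rw [← span_natCast_rat_eq hℓ hℓv, Ideal.map_span, Set.image_singleton, map_natCast]
    have hne : v.asIdeal.map (algebraMap (𝓞 ℚ) (𝓞 K)) ≠ ⊥ := by
      rw [hmap, Ne, Ideal.span_singleton_eq_bot]; exact_mod_cast hℓ.ne_zero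
    rw [← hmap, ← Ideal.IsDedekindDomain.ramificationIdx_eq_normalizedFactors_count v.asIdeal
      w.asIdeal hne]
    exact Ideal.ramificationIdx_eq_one_iff.mpr (hunr w.asIdeal w.isPrime inferInstance)
  -- ### Step G: the value of the cocycle at `τ'`
  have hξm : ξ m = 0 := by
    have h := hm.2 0
    simp only [Matrix.cons_val_zero] at h
    exact h
  have hξs : ξ s = y := by
    rw [hs, hcoc, hρy, hξm, smul_zero, add_zero]
  have hBT : ht.conjGalCMH s ∈ torsionFixing (W.baseChange K) ((p : ℕ) : ℤ) :=
    ht.conjGalCMH_mem_torsionFixing W hinv _ hsT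
  have hξcs : ξ (ht.conjGalCMH s) = ν • T y := by
    have hcm : ht.conjGalCMH m ∈ 𝒩 :=
      ht.conjGalCMH_mem_evalKer W hinv _ (xs := ![x]) (ν := fun _ ↦ ν) (fun _ ↦ hν)
        (fun i ↦ by fin_cases i; simpa using hxν) hm
    have hcs : ht.conjGalCMH s = ht.conjGalCMH ρ * ht.conjGalCMH m := by
      change ht.conjGalHom (ρ * m) = ht.conjGalHom ρ * ht.conjGalHom m
      exact map_mul _ _ _
    have h1 : ξ (ht.conjGalCMH ρ) = ν • T (ξ ρ) := ht.h1Eval_conjGalCMH_of_eigen W hinv _ hν hxν hρT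
    have h2 : ξ (ht.conjGalCMH m) = 0 := by
      have h := hcm.2 0
      simp only [Matrix.cons_val_zero] at h
      exact h
    rw [hcs, hcoc, smul_eq_of_mem_torsionFixing _ _ (ht.conjGalCMH_mem_torsionFixing W hinv _ hρT), h1, h2,
      add_zero, hρy]
  have hcg : ht.conjGalCMH g = ht.conjGalCMH g₁ * ht.conjGalCMH s := by
    change ht.conjGalHom (g₁ * s) = ht.conjGalHom g₁ * ht.conjGalHom s
    exact map_mul _ _ _
  -- `e`-linearity for scalars `ν`
  have heν : ∀ (X : geomTorsion (W.baseChange K) ((p : ℕ) : ℤ)) (i : Fin 2), eT (ν • X) i = (ν : ZMod p) * eT X i :=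
    fun X i ↦ by rw [map_zsmul, Pi.smul_apply, ← Int.cast_smul_eq_zsmul (ZMod p) ν (eT X i), smul_eq_mul]
  have hξτ' : ξ τ' = κ₀ + (ν • T (g₁ • y) + T (g₁ • T (g₁ • y))) := by
    -- `ξ(conj(g₁) conj(s) g₁ s) = κ₀ + conj(g₁) • (ν T y + g₁ y)`
    rw [hτ'eq, hcg, hg, hcoc, hcoc, hcoc, hξs, hξcs,
      mul_smul (ht.conjGalCMH g₁) (ht.conjGalCMH s) (ξ g₁ + g₁ • y), smul_eq_of_mem_torsionFixing _ _ hBT]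
    have e1 : ξ (ht.conjGalCMH g₁) + ht.conjGalCMH g₁ • ν • T y + ht.conjGalCMH g₁ • (ξ g₁ + g₁ • y) =
        κ₀ + ht.conjGalCMH g₁ • (ν • T y + g₁ • y) := by
      rw [← hκ₀, hcoc, smul_add, smul_add]; abel
    rw [e1, hconj, map_add, map_zsmul, hTT, smul_add, smul_comm g₁ ν y, map_add, map_zsmul]
  have hξτ'0 : eT (ξ τ') 0 = 1 := by
    rw [hξτ', map_add, map_add, Pi.add_apply, Pi.add_apply, heν, (hD1 y).1, (hD2 y).1, hy0, ← mul_assoc, hννk,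
      one_mul]
    have : (2 : ZMod p)⁻¹ * 2 = 1 := inv_mul_cancel₀ htwo
    linear_combination (1 - eT κ₀ 0) * this
  -- the action of `τ'` on `E(K̄)[p]`: `τ' M = T g₁ T g₁ M`, first coordinate unchanged
  have hτ'M : ∀ M : geomTorsion (W.baseChange K) ((p : ℕ) : ℤ), τ' • M = T (g₁ • T (g₁ • M)) := fun M ↦ by
    rw [hτ'eq, hcg, hg]
    simp only [mul_smul, smul_eq_of_mem_torsionFixing _ _ hsT, smul_eq_of_mem_torsionFixing _ _ hBT]
    rw [hconj]
  have hnot : ¬ ∃ M : geomTorsion (W.baseChange K) ((p : ℕ) : ℤ), ξ τ' = τ' • M - M := by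
    rintro ⟨M, hM⟩
    have h : eT (ξ τ') 0 = eT (τ' • M - M) 0 := by rw [hM]
    rw [hξτ'0, map_sub, Pi.sub_apply, hτ'M, (hD2 M).1, sub_self] at h
    exact one_ne_zero h
  -- `γ = c₀ · res g` acts on `E(ℚ̄)[p]` as `D` (through `eT ∘ θ`)
  have hact : ∀ P : geomTorsion W ((p : ℕ) : ℤ),
      (θ.trans eT) ((c₀ * absGaloisRestrict ℚ K g) • P) =
        ![(ν : ZMod p) * (θ.trans eT) P 0, (ν : ZMod p) * 2 * (θ.trans eT) P 1] := fun P ↦ by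
    have hresg : absGaloisRestrict ℚ K g = absGaloisRestrict ℚ K g₁ * absGaloisRestrict ℚ K s := by
      change absGaloisRestrict ℚ K (g₁ * s) = _
      exact map_mul _ _ _
    rw [AddEquiv.trans_apply, AddEquiv.trans_apply, hresg, ← mul_assoc,
      mul_smul (c₀ * absGaloisRestrict ℚ K g₁) (absGaloisRestrict ℚ K s) P,
      absGaloisRestrict_smul_eq_of_mem_torsionFixing W hsT]
    exact hγ₁ P
  have hmod := isAdmissible_congruences_of_frob W h5 hℓp' hgoodℓ hvℓ h𝔓₀ hγ (θ.trans eT) hν hact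
  -- ### Step H: assemble
  have hℓpN : ¬ ℓ ∣ p * W.conductorNorm ℤ := by
    intro h
    rcases (Nat.Prime.dvd_mul hℓ).mp h with h' | h'
    · exact hℓp' ((Nat.prime_dvd_prime_iff_eq hℓ hp).mp h')
    · exact hℓN' h'
  refine ⟨ℓ, hℓB₀, ⟨hℓ, hℓpN, hspan ▸ w.isPrime, hmod.1, hmod.2⟩, w, hℓw, fun hxker ↦ ?_⟩
  -- ### the local criterion at `w` (Gross Prop. 9.6 at the non-trivial Frobenius `δ τ' δ⁻¹`)
  haveI : CharZero (w.adicCompletion K) :=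
    charZero_of_injective_algebraMap (algebraMap K (w.adicCompletion K)).injective
  obtain ⟨𝔐, h𝔐⟩ := w.localPrimesAbove_nonempty
  set 𝔓w := w.primeBelow (closureEmb (K := K) (w.adicCompletion K)) 𝔐 with h𝔓w_def
  have h𝔓w : 𝔓w ∈ w.primesAbove := w.primeBelow_mem_primesAbove h𝔐
  haveI : 𝔓w.IsPrime := h𝔓w.1
  obtain ⟨δ, -, hF⟩ := HeightOneSpectrum.exists_isArithFrobAt_conj_of_mem_primesAbove_holds h𝔔w h𝔓w hτ'
  have hwbad : w ∉ (W.baseChange K).badPlaces (𝓞 K) := fun h ↦ hvS₃ ⟨w, Or.inl h, hwv⟩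
  have hwT : w ∉ Tx := fun h ↦ hvS₃ ⟨w, Or.inr h, hwv⟩
  have hpw : ((((p : ℕ) : ℤ)) : 𝓞 K) ∉ w.asIdeal := by
    rw [Int.cast_natCast]
    exact not_natCast_mem_of_prime_ne hℓ hp hℓp' w hℓw
  have hIw : 𝔓w.inertia (absoluteGaloisGroup K) ≤ torsionFixing (W.baseChange K) ((p : ℕ) : ℤ) :=
    inertia_le_torsionFixing (W.baseChange K) hwbad hpw _ h𝔐
  have hφI : ∀ i ∈ 𝔓w.inertia (absoluteGaloisGroup K), φ.1 i = 0 := by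
    have hx' : oneCocycleClass _ φ ∈ unramifiedKer (geomTorsion (W.baseChange K) ((p : ℕ) : ℤ)) 𝔓w := by
      rw [hclass]; exact hTx w hwT 𝔓w h𝔓w
    obtain ⟨a, ha⟩ := (oneCocycleClass_mem_subgroupResKer_iff _ φ).mp hx'
    intro i hi
    rw [ha ⟨i, hi⟩, Subgroup.coe_mk, smul_eq_of_mem_torsionFixing (W.baseChange K) _ (hIw hi), sub_self]
  have hcrit := LocalFrob.oneCocycleClass_mem_torsionLocalKer_iff_apply_frob (W.baseChange K) (n := p)
    hp.ne_zero h𝔐 hF hIw φ hφI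
  rw [hclass] at hcrit
  obtain ⟨m', hm'⟩ := hcrit.mp hxker
  have hm'' : ξ (δ * τ' * δ⁻¹) = (δ * τ' * δ⁻¹) • m' - m' := hm'
  -- from `ξ(δ τ' δ⁻¹) = ∂m'` to `ξ(τ') = ∂M` with `M = δ⁻¹ (m' + ξ δ)`
  apply hnot
  refine ⟨δ⁻¹ • (m' + ξ δ), (smul_left_cancel_iff δ).mp ?_⟩
  have h1 : ξ (δ * τ' * δ⁻¹) = ξ δ + δ • ξ τ' - (δ * τ' * δ⁻¹) • ξ δ := by
    rw [hcoc, hcoc, hξinv δ, smul_neg, mul_smul (δ * τ') δ⁻¹ (ξ δ)]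
    abel
  rw [h1] at hm''
  have hR : δ • (τ' • (δ⁻¹ • (m' + ξ δ)) - δ⁻¹ • (m' + ξ δ)) =
      (δ * τ' * δ⁻¹) • (m' + ξ δ) - (m' + ξ δ) := by
    rw [smul_sub, smul_inv_smul, mul_smul (δ * τ') δ⁻¹ (m' + ξ δ), mul_smul δ τ' (δ⁻¹ • (m' + ξ δ))]
  have e : δ • ξ τ' = (ξ δ + δ • ξ τ' - (δ * τ' * δ⁻¹) • ξ δ) - ξ δ + (δ * τ' * δ⁻¹) • ξ δ := by
    abel
  rw [hR, e, hm'', smul_add]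
  abel

end Main

end Summit.BirchSwinnertonDyer.BirchSwinnertonDyer.Theorems.SignedBaseChangeAcDivAdmdefChebSplit

end
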